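import Mathlib.Topology.KrullDimension
import Mathlib.Topology.Sober
import Mathlib.Topology.NoetherianSpace
import Mathlib.Topology.JacobsonSpace
import Mathlib.Order.KrullDimension
import HarnessLib

/-!
# Dimension zero: specialisations, discrete spaces, isolated components

Elementary point-set facts about subsets of topological Krull dimension `≤ 0` (Mathlib
`topologicalKrullDim`: supremum of lengths of chains of irreducible closed subsets) and about
isolated points, as they enter dimension counts on fibres of morphisms of schemes ("the
intersection `H ∩ f⁻¹(y)` has dimension `≤ 0`", "a curve has no isolated points"):

* `eq_of_specializes_of_topologicalKrullDim_le_zero` — in a `T₀` space of dimension `≤ 0`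
  there are no proper specialisations (`x ⤳ x'` forces `x = x'`), and the same for any subset
  carrying the subspace topology (`Set.eq_of_specializes_of_topologicalKrullDim_le_zero`); hence
  points of a closed subset of dimension `≤ 0` are closed points
  (`Set.isClosed_singleton_of_topologicalKrullDim_le_zero`);
* conversely a FINITE subset without proper specialisations has dimension `≤ 0`
  (`Set.Finite.topologicalKrullDim_le_zero`: it is a finite `T₁`, hence discrete, space, and
  `topologicalKrullDim_le_zero_of_discreteTopology`);
* isolated points and components: an irreducible discrete space is a singleton
  (`Set.subsingleton_of_discreteTopology_of_isIrreducible`); a one-point irreducible component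
  of a space with finitely many irreducible components is open
  (`isOpen_of_singleton_mem_irreducibleComponents`); an open-and-closed point is an irreducible
  component of dimension `0` (`singleton_mem_irreducibleComponents_of_isClopen`,
  `topologicalKrullDim_singleton`); in a Jacobson space an open point is closed
  (Mathlib `isClosed_singleton_of_isLocallyClosed_singleton`).

## References

* U. Görtz, T. Wedhorn, *Algebraic Geometry I: Schemes*, 2nd ed. (2020), (5.3) Definition of
  dimension (p. 151) and (5.4) Dimension 0 (p. 154). [GortzWedhorn2020]
-/

open Order TopologicalSpace Topology Set

noncomputable section

namespace Literature.Topology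

variable {X : Type*} [TopologicalSpace X]

/-! ### No proper specialisations in dimension `≤ 0` -/

/-- In a `T₀` space a proper specialisation `x ⤳ x'`, `x ≠ x'`, gives the strict chain
`cl{x'} ⊊ cl{x}` of irreducible closed subsets, so the dimension is not `≤ 0`. [folklore] -/
theorem eq_of_specializes_of_topologicalKrullDim_le_zero [T0Space X]
    (h : topologicalKrullDim X ≤ 0) {x x' : X} (hx : x ⤳ x') : x = x' := by
  have hmax : ∀ A : IrreducibleCloseds X, IsMax A := Order.krullDim_nonpos_iff_forall_isMax.mp h
  by_contra hne
  let A : IrreducibleCloseds X := ⟨closure {x'}, isIrreducible_singleton.closure, isClosed_closure⟩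
  let B : IrreducibleCloseds X := ⟨closure {x}, isIrreducible_singleton.closure, isClosed_closure⟩
  have hAB : A ≤ B := by
    change closure {x'} ⊆ closure {x}
    exact closure_minimal (singleton_subset_iff.mpr (specializes_iff_mem_closure.mp hx))
      isClosed_closure
  have hBA : B ≤ A := hmax A hAB
  have hxA : x ∈ closure ({x'} : Set X) := hBA (subset_closure (mem_singleton x))
  have hx' : x' ⤳ x := specializes_iff_mem_closure.mpr hxA
  exact hne (hx.antisymm hx').eq

/-- **A subset of dimension `≤ 0` (subspace topology) of a `T₀` space contains no proper
specialisation**: if `a, b ∈ S` and `a ⤳ b` then `a = b`. [folklore] -/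
theorem Set.eq_of_specializes_of_topologicalKrullDim_le_zero [T0Space X] {S : Set X}
    (h : topologicalKrullDim S ≤ 0) {a b : X} (ha : a ∈ S) (hb : b ∈ S) (hab : a ⤳ b) :
    a = b := by
  have h' : (⟨a, ha⟩ : S) ⤳ ⟨b, hb⟩ := (subtype_specializes_iff _ _).mpr hab
  exact congrArg Subtype.val
    (Literature.Topology.eq_of_specializes_of_topologicalKrullDim_le_zero h h')

/-- **Points of a closed subset of dimension `≤ 0` are closed points.** [folklore] -/
theorem Set.isClosed_singleton_of_topologicalKrullDim_le_zero [T0Space X] {S : Set X}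
    (hS : IsClosed S) (h : topologicalKrullDim S ≤ 0) {a : X} (ha : a ∈ S) :
    IsClosed ({a} : Set X) := by
  have hcl : closure ({a} : Set X) = {a} := by
    refine Subset.antisymm (fun b hb => ?_) subset_closure
    have hbS : b ∈ S := closure_minimal (singleton_subset_iff.mpr ha) hS hb
    exact (Set.eq_of_specializes_of_topologicalKrullDim_le_zero h ha hbS
      (specializes_iff_mem_closure.mpr hb)).symm ▸ mem_singleton a
  rw [← hcl]
  exact isClosed_closure

/-! ### Finite sets without specialisations have dimension `≤ 0` -/

/-- A set without proper specialisations among its points is a `T₁` subspace. [folklore] -/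
theorem Set.t1Space_of_forall_specializes_eq {S : Set X}
    (h : ∀ a ∈ S, ∀ b ∈ S, a ⤳ b → a = b) : T1Space S := by
  rw [t1Space_iff_specializes_imp_eq]
  intro a b hab
  exact Subtype.ext (h a.1 a.2 b.1 b.2 ((subtype_specializes_iff _ _).mp hab))

/-- **A finite subset without proper specialisations has dimension `≤ 0`**: it is a finite `T₁`
space, hence discrete (Mathlib `topologicalKrullDim_zero_of_discreteTopology`). [folklore] -/
theorem Set.Finite.topologicalKrullDim_le_zero {S : Set X} (hS : S.Finite)
    (h : ∀ a ∈ S, ∀ b ∈ S, a ⤳ b → a = b) : topologicalKrullDim S ≤ 0 := by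
  haveI : Finite S := hS.to_subtype
  haveI : T1Space S := Set.t1Space_of_forall_specializes_eq h
  exact topologicalKrullDim_zero_of_discreteTopology S

/-! ### Isolated points and irreducible components -/

/-- An irreducible subset whose subspace topology is discrete is a single point: two of its
points are cut out by opens of the ambient space, which an irreducible set cannot meet
separately. [folklore] -/
theorem Set.subsingleton_of_isIrreducible_of_discreteTopology {G : Set X} [DiscreteTopology G]
    (hG : IsIrreducible G) : G.Subsingleton := fun u hu v hv => by
  by_contra huv
  -- opens of `X` cutting out `u` and `v` inside `G`
  obtain ⟨U, hU, hUG⟩ := isOpen_induced_iff.mp (isOpen_discrete ({⟨u, hu⟩} : Set G))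
  obtain ⟨V, hV, hVG⟩ := isOpen_induced_iff.mp (isOpen_discrete ({⟨v, hv⟩} : Set G))
  have huU : u ∈ U := by
    have : (⟨u, hu⟩ : G) ∈ Subtype.val ⁻¹' U := by rw [hUG]; exact mem_singleton _
    exact this
  have hvV : v ∈ V := by
    have : (⟨v, hv⟩ : G) ∈ Subtype.val ⁻¹' V := by rw [hVG]; exact mem_singleton _
    exact this
  obtain ⟨w, hwG, hwU, hwV⟩ := hG.isPreirreducible U V hU hV ⟨u, hu, huU⟩ ⟨v, hv, hvV⟩
  have hwu : (⟨w, hwG⟩ : G) ∈ Subtype.val ⁻¹' U := hwU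
  have hwv : (⟨w, hwG⟩ : G) ∈ Subtype.val ⁻¹' V := hwV
  rw [hUG, mem_singleton_iff] at hwu
  rw [hVG, mem_singleton_iff] at hwv
  exact huv ((congrArg Subtype.val hwu).symm.trans (congrArg Subtype.val hwv))

/-- Two irreducible components, one contained in the other, are equal. [folklore] -/
theorem eq_of_mem_irreducibleComponents_of_subset {C C' : Set X} (hC : C ∈ irreducibleComponents X)
    (hC' : C' ∈ irreducibleComponents X) (h : C ⊆ C') : C = C' :=
  Subset.antisymm h (hC.2 hC'.1 h)

/-- **A one-point irreducible component is open** when there are only finitely many irreducible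
components (e.g. in a Noetherian space): its complement is the union of the other components.
[folklore] -/
theorem isOpen_of_singleton_mem_irreducibleComponents (hfin : (irreducibleComponents X).Finite)
    {ξ : X} (hξ : ({ξ} : Set X) ∈ irreducibleComponents X) : IsOpen ({ξ} : Set X) := by
  have hcompl : ({ξ} : Set X)ᶜ = ⋃ C ∈ irreducibleComponents X \ {{ξ}}, C := by
    ext x
    simp only [mem_compl_iff, mem_singleton_iff, mem_iUnion, mem_sdiff, exists_prop]
    constructor
    · intro hx
      refine ⟨irreducibleComponent x, ⟨irreducibleComponent_mem_irreducibleComponents x, ?_⟩,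
        mem_irreducibleComponent⟩
      intro hC
      exact hx (mem_singleton_iff.mp (hC ▸ mem_irreducibleComponent (x := x)))
    · rintro ⟨C, ⟨hC, hCne⟩, hxC⟩ rfl
      exact hCne (eq_of_mem_irreducibleComponents_of_subset hξ hC (singleton_subset_iff.mpr hxC)).symm
  rw [← isClosed_compl_iff, hcompl]
  exact (hfin.sdiff).isClosed_biUnion fun C hC => isClosed_of_mem_irreducibleComponents C hC.1

/-- **An open-and-closed point is an irreducible component.** [folklore] -/
theorem singleton_mem_irreducibleComponents_of_isClopen {ξ : X} (hξ : IsClopen ({ξ} : Set X)) :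
    ({ξ} : Set X) ∈ irreducibleComponents X := by
  refine ⟨isIrreducible_singleton, fun Z hZ hξZ => ?_⟩
  -- `Z` irreducible meets the open `{ξ}` and, if it had another point, the open `{ξ}ᶜ`
  intro z hz
  by_contra hne
  obtain ⟨w, hw1, hw2⟩ := hZ.isPreirreducible {ξ} {ξ}ᶜ hξ.isOpen hξ.compl.isOpen
    ⟨ξ, hξZ rfl, mem_singleton ξ⟩ ⟨z, hz, hne⟩
  exact hw2.2 hw2.1

/-- A one-point space has dimension `0`. [folklore] -/
theorem topologicalKrullDim_singleton (ξ : X) : topologicalKrullDim ({ξ} : Set X) = 0 := by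
  apply le_antisymm
  · exact topologicalKrullDim_zero_of_discreteTopology _
  · haveI : Nonempty (IrreducibleCloseds ({ξ} : Set X)) :=
      ⟨⟨closure {⟨ξ, mem_singleton ξ⟩}, isIrreducible_singleton.closure, isClosed_closure⟩⟩
    exact Order.krullDim_nonneg

/-- **In a Jacobson space an open point is a closed point** (closed points are dense in every
locally closed subset). [folklore] -/
theorem isClosed_singleton_of_isOpen_singleton [JacobsonSpace X] {ξ : X}
    (hξ : IsOpen ({ξ} : Set X)) : IsClosed ({ξ} : Set X) :=
  isClosed_singleton_of_isLocallyClosed_singleton hξ.isLocallyClosed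

end Literature.Topology

end
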